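import Summits.AtomisticToContinuum.Crystallization.Theses.FreeSplittingCertificates
import Summits.AtomisticToContinuum.Crystallization.Theorems.FreeSplittingCertificatesStrictSplittingRuleDefs
import Summits.AtomisticToContinuum.Crystallization.Theorems.ExcessDecayLiouvilleCoarseGrainsHcpEnergySeries
import Summits.AtomisticToContinuum.Crystallization.Theorems.PalmUnimodularRigidityLayeredLawsSelectHcpRelaxedReference

/-!
# `StrictSplittingRule` (stmt-AtomisticToContinuum-12560), line `birth`: stub `stub_hcpFamilyMinExists`

Sub-goal S0a of the line `birth` of crux r3 `StrictSplittingRule` (route `FreeSplittingCertificates`):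
EXISTENCE OF A GLOBAL MINIMISER OF THE hcp-FAMILY LENNARD-JONES ENERGY PER PARTICLE.  Some `a, h > 0`
satisfy `HcpFamilyMin a h` (vocabulary module `…FreeSplittingCertificatesStrictSplittingRuleDefs`): the
relaxed hexagonal close packing `hcp(a, h)` (`hcpPeriodicConfiguration`, in-layer spacing `a`, layer
spacing `h`; `BarlowStacking.lean`) minimises the Lennard-Jones energy per particle
(`PeriodicConfiguration.energyPerParticle`, Blanc–Lewin 2015, §2.1 (23)) over the whole two-parameter
family `a', h' > 0`.

Proof — bookkeeping over two landed facts, all `[folklore]`: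

* `ExcessDecayLiouvilleCoarseGrains.hcpEnergySeries_of_eq` (third clause): for `a, h ≠ 0` the energy per
  particle of `hcpPeriodicConfiguration ha hh` is the explicit `ℤ³`-series
  `½ ∑_{v ≠ 0} V_LJ(√(a² Q v + k² h²))`, which is LITERALLY the total function
  `PalmUnimodularRigidity.LayeredLawsSelectHcp.hcpE a h` (`hcpQ` is that `Q`, by `rfl`);
* `PalmUnimodularRigidity.LayeredLawsSelectHcp.stub_relaxedReference`: `hcpE` has a global minimiser
  `(a₀, h₀)` over the open quadrant `{a > 0, h > 0}` with `189/200 ≤ a₀`, `77/100 ≤ h₀` (scaling +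
  AM–GM reduce to the shape function `S₃²/S₆` of the certified lattice sums `hcpSumS`, whose maximum on
  the compact box `[39/50, 17/20]` is global by the certified exclusion outside the box).

So `(a₀, h₀)` witnesses `HcpFamilyMin`: read both energies as `hcpE` and apply the minimality.
-/

noncomputable section

namespace Summit.AtomisticToContinuum.Crystallization.Theorems.StrictSplittingRuleBirth

open scoped BigOperators Classical
open Literature.MathematicalPhysics.StatisticalMechanics
open Literature.Geometry.DiscreteGeometry
open Summit.AtomisticToContinuum.Crystallization.Theorems.PalmUnimodularRigidity.LayeredLawsSelectHcp
  (hcpE hcpQ stub_relaxedReference)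
open Summit.AtomisticToContinuum.Crystallization.Theorems.ExcessDecayLiouvilleCoarseGrains
  (hcpEnergySeries_of_eq)

/-- `hcpE a h = e(hcp a h)` for `a, h ≠ 0`: third clause of the landed series theorem
`hcpEnergySeries_of_eq` (its right-hand side is `hcpE a h` by `rfl`, `hcpQ` being the form `Q`).
[folklore] -/
private theorem hcpFamilyMinExists_hcpE_eq {a h : ℝ} (ha : a ≠ 0) (hh : h ≠ 0) :
    hcpE a h = (hcpPeriodicConfiguration ha hh).energyPerParticle lennardJones :=
  ((hcpEnergySeries_of_eq a h ha hh hcpQ rfl).2.2).symm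

/-- **S0a** (stub `stub_hcpFamilyMinExists` of line `birth`, crux `StrictSplittingRule`,
stmt-AtomisticToContinuum-12560): EXISTENCE OF A GLOBAL MINIMISER OF THE hcp-FAMILY LENNARD-JONES ENERGY
PER PARTICLE.  Some `a, h > 0` make `hcp(a, h)` minimise `e(hcp a' h')` over all `a', h' > 0`: the landed
global minimiser `(a₀, h₀)` of the total function `hcpE` (`stub_relaxedReference`; `a₀ ≥ 189/200`,
`h₀ ≥ 77/100`), both energies read as `hcpE` through `hcpEnergySeries_of_eq`. [folklore] -/
theorem stub_hcpFamilyMinExists : ∃ a h : ℝ, 0 < a ∧ 0 < h ∧ HcpFamilyMin a h := by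
  obtain ⟨a₀, h₀, ha₁, -, hh₁, -, hmin⟩ := stub_relaxedReference
  have ha0 : 0 < a₀ := by linarith
  have hh0 : 0 < h₀ := by linarith
  refine ⟨a₀, h₀, ha0, hh0, ha0.ne', hh0.ne', fun a' h' ha' hh' ha'0 hh'0 => ?_⟩
  rw [← hcpFamilyMinExists_hcpE_eq ha0.ne' hh0.ne', ← hcpFamilyMinExists_hcpE_eq ha' hh']
  exact hmin a' h' ha'0 hh'0

end Summit.AtomisticToContinuum.Crystallization.Theorems.StrictSplittingRuleBirth

end
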